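import Mathlib

/-!
# SoloBlindSplittingDevissage — splitting descent passes from two-weight pieces to three

Solo-blind programme on `Summit.KontsevichZagierPeriods` (Kontsevich–Zagier period conjecture in the
effective Nori form), session s71.  Kernel form of the INDUCTION STEP of PROPOSITION W′ (iii) ⟹ (ii)
(`paper/inj-sectors.md` §13, claim C674; second context `paper/selfref-s71.md` §B): over a
Hodge-conjecture sector, effective fullness of Nori motives ("Inj") is equivalent to SPLITTING
DESCENT — an extension of effective motives that splits after the Lefschetz motive is inverted
already splits effectively — and it suffices to know splitting descent for TWO-WEIGHT objects.

The shadow.  The faithful exact functor `Φ : MM^eff → MM` is modelled by restriction of scalars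
along an algebra `A → B`: an effective object is a `B`-module `E`, its effective subobjects are the
`B`-submodules, and the subobjects of `Φ(E)` are the `A`-submodules (`Submodule.restrictScalars`).
For a three-step weight filtration `Wa ≤ Wb ≤ E` the theorem `exists_compl_of_two_step` says:
if (iv′) `A`-complements of `Wa` inside `Wb` are unique (in the motive: `Hom(W_b/W_a, W_a) = 0` by
strictness of weights — the torsor theorem `compl_eq_of_forall_hom_eq_zero` of
`SoloBlindComplementUnique` turns that into uniqueness), (D1) splitting descent holds for the
two-weight object `Wb`, and (D3) splitting descent holds for the two-weight subquotients `E ⧸ P`,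
`P` an effective complement of `Wa` in `Wb` (phrased inside `E`: submodules `R ⊇ P` with
`R ⊓ Wb = P`, `R ⊔ Wa = ⊤`), THEN splitting descent holds for `E` itself: an `A`-complement of
`Wa` in `E` yields a `B`-complement.  This is the diagram chase behind Ito–Kato–Nakayama–Usui,
*On log motives* (2020), Lemma 4.3.3(2), written without `Ext` groups; iterating it along the weight
filtration (replace `E` by `E ⧸ P`) is the induction of PROP W′.

Main results (`A → B` an algebra, `E` a `B`-module with compatible `A`-action):
* `restrictScalars_inf_eq_bot`, `restrictScalars_sup_eq` — an effective complement is a complement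
  downstairs;
* `inf_restrictScalars_compl` — an `A`-complement of `Wa` in `E` cuts `Wb ⊇ Wa` in an
  `A`-complement of `Wa` in `Wb` (modular law);
* `exists_compl_of_two_step` — the induction step above;
* `exists_compl_of_two_step'` — the same with (iv′) replaced by its source, the vanishing of all
  `A`-linear maps from a complement into `Wa`.
Complete proofs; no axioms beyond the standard three.
-/

namespace Summit.KontsevichZagierPeriods.KontsevichZagierPeriods.Theorems

open Submodule

universe u v w

variable {A : Type u} {B : Type v} {E : Type w} [CommRing A] [Ring B] [Algebra A B]
  [AddCommGroup E] [Module A E] [Module B E] [IsScalarTower A B E]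

/-- If `P ⊓ Q = ⊥` for `B`-submodules then the same holds for the underlying `A`-submodules. -/
theorem restrictScalars_inf_eq_bot {P Q : Submodule B E} (h : P ⊓ Q = ⊥) :
    P.restrictScalars A ⊓ Q.restrictScalars A = ⊥ := by
  rw [← restrictScalars_inf, h, restrictScalars_bot]

/-- If `P ⊔ Q = T` for `B`-submodules then the same holds for the underlying `A`-submodules. -/
theorem restrictScalars_sup_eq {P Q T : Submodule B E} (h : P ⊔ Q = T) :
    P.restrictScalars A ⊔ Q.restrictScalars A = T.restrictScalars A := by
  rw [← restrictScalars_sup, h]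

/-- Modular-law step: an `A`-complement `N` of `Wa` in `E` meets `Wb ⊇ Wa` in an `A`-complement of
`Wa` inside `Wb`. -/
theorem inf_restrictScalars_compl {Wa Wb : Submodule B E} (hab : Wa ≤ Wb) {N : Submodule A E}
    (hNinf : N ⊓ Wa.restrictScalars A = ⊥) (hNsup : N ⊔ Wa.restrictScalars A = ⊤) :
    (N ⊓ Wb.restrictScalars A) ⊓ Wa.restrictScalars A = ⊥ ∧
      (N ⊓ Wb.restrictScalars A) ⊔ Wa.restrictScalars A = Wb.restrictScalars A := by
  have hab' : Wa.restrictScalars A ≤ Wb.restrictScalars A := (restrictScalars_le A).2 hab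
  constructor
  · rw [inf_assoc, inf_eq_right.2 hab', hNinf]
  · have hmod := sup_inf_assoc_of_le N hab'
    -- hmod : (Wa' ⊔ N) ⊓ Wb' = Wa' ⊔ N ⊓ Wb'
    rw [sup_comm, ← hmod, sup_comm, hNsup, top_inf_eq]

/-- **Splitting descent passes from two weights to three** (induction step of PROP W′ (iii) ⟹ (ii)).
`Wa ≤ Wb` are `B`-submodules of `E` (the two lowest steps of the weight filtration).  Hypotheses:
(iv′) `A`-complements of `Wa` inside `Wb` are unique; (D1) if `Wa` has an `A`-complement inside
`Wb` it has a `B`-complement inside `Wb`; (D3) for every `B`-complement `P` of `Wa` in `Wb`: if there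
is an `A`-submodule `N ⊇ P` with `N ⊓ Wb = P` and `N ⊔ Wa = ⊤` (an `A`-complement of `Wa` in
`E ⧸ P`) then there is a `B`-submodule `R ⊇ P` with `R ⊓ Wb = P` and `R ⊔ Wa = ⊤`.  Conclusion: if
`Wa` has an `A`-complement in `E` then it has a `B`-complement in `E`. -/
theorem exists_compl_of_two_step (Wa Wb : Submodule B E) (hab : Wa ≤ Wb)
    (huniq : ∀ N N' : Submodule A E,
      N ⊓ Wa.restrictScalars A = ⊥ → N ⊔ Wa.restrictScalars A = Wb.restrictScalars A →
      N' ⊓ Wa.restrictScalars A = ⊥ → N' ⊔ Wa.restrictScalars A = Wb.restrictScalars A → N = N')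
    (hD1 : (∃ N : Submodule A E,
        N ⊓ Wa.restrictScalars A = ⊥ ∧ N ⊔ Wa.restrictScalars A = Wb.restrictScalars A) →
      ∃ P : Submodule B E, P ⊓ Wa = ⊥ ∧ P ⊔ Wa = Wb)
    (hD3 : ∀ P : Submodule B E, P ⊓ Wa = ⊥ → P ⊔ Wa = Wb →
      (∃ N : Submodule A E, P.restrictScalars A ≤ N ∧
          N ⊓ Wb.restrictScalars A = P.restrictScalars A ∧ N ⊔ Wa.restrictScalars A = ⊤) →
      ∃ R : Submodule B E, P ≤ R ∧ R ⊓ Wb = P ∧ R ⊔ Wa = ⊤)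
    (hN : ∃ N : Submodule A E, N ⊓ Wa.restrictScalars A = ⊥ ∧ N ⊔ Wa.restrictScalars A = ⊤) :
    ∃ R : Submodule B E, R ⊓ Wa = ⊥ ∧ R ⊔ Wa = ⊤ := by
  obtain ⟨N, hNinf, hNsup⟩ := hN
  -- Step 1: `N ⊓ Wb` is an `A`-complement of `Wa` inside `Wb` (modular law).
  obtain ⟨h1inf, h1sup⟩ := inf_restrictScalars_compl (A := A) hab hNinf hNsup
  -- Step 2: two-weight descent (D1) gives an effective complement `P` of `Wa` in `Wb`.
  obtain ⟨P, hPinf, hPsup⟩ := hD1 ⟨N ⊓ Wb.restrictScalars A, h1inf, h1sup⟩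
  -- Step 3: by uniqueness (iv′) the two `A`-complements `N ⊓ Wb` and `P` of `Wa` in `Wb` agree.
  have hNP : N ⊓ Wb.restrictScalars A = P.restrictScalars A :=
    huniq _ _ h1inf h1sup (restrictScalars_inf_eq_bot hPinf) (restrictScalars_sup_eq hPsup)
  -- Step 4: hence `N` is an `A`-complement of `Wa` in `E ⧸ P`; two-weight descent (D3) gives `R`.
  have hPN : P.restrictScalars A ≤ N := by
    rw [← hNP]
    exact inf_le_left
  obtain ⟨R, -, hRinf, hRsup⟩ := hD3 P hPinf hPsup ⟨N, hPN, hNP, hNsup⟩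
  -- Step 5: `R` is a `B`-complement of `Wa` in `E`: `R ⊓ Wa = (R ⊓ Wb) ⊓ Wa = P ⊓ Wa = ⊥`.
  refine ⟨R, ?_, hRsup⟩
  have key : R ⊓ Wa = (R ⊓ Wb) ⊓ Wa := by rw [inf_assoc, inf_eq_right.2 hab]
  rw [key, hRinf, hPinf]

/-- Uniqueness of complements from the vanishing of Hom: if `N'` is an `A`-complement of `Q`
inside `T`, `N ⊔ Q = T` as well, and every `A`-linear map `N → Q` vanishes, then `N = N'` (the
hypothesis `N ⊓ Q = ⊥` is not even needed).  (Self-contained re-derivation of the mechanism of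
`SoloBlindComplementUnique.compl_eq_of_forall_hom_eq_zero` in the relative setting `… = T`; in the
motive, `Hom(W_b/W_a, W_a) = 0` because morphisms of Nori motives are strict for the weight
filtration.) -/
theorem compl_unique_of_forall_hom_eq_zero {Q T N N' : Submodule A E}
    (hNT : N ⊔ Q = T) (hN' : N' ⊓ Q = ⊥) (hN'T : N' ⊔ Q = T)
    (hHom : ∀ f : N →ₗ[A] Q, f = 0) : N = N' := by
  -- The difference map: for `n ∈ N ≤ T = N' ⊔ Q` write `n = n' + q`; `n ↦ q` is `A`-linear `N → Q`.
  have hdec : ∀ n : N, ∃ q : Q, (n : E) - (q : E) ∈ N' := by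
    intro n
    have hn : (n : E) ∈ N' ⊔ Q := by
      rw [hN'T, ← hNT]
      exact mem_sup_left n.2
    obtain ⟨y, hy, z, hz, hyz⟩ := mem_sup.1 hn
    exact ⟨⟨z, hz⟩, by simpa [← hyz] using hy⟩
  choose g hg using hdec
  -- uniqueness of the decomposition: `N' ⊓ Q = ⊥`
  have huq : ∀ (n : N) (q : Q), (n : E) - (q : E) ∈ N' → q = g n := by
    intro n q hq
    have hmem : (q : E) - (g n : E) ∈ N' ⊓ Q := by
      refine ⟨?_, Q.sub_mem q.2 (g n).2⟩
      have := N'.sub_mem (hg n) hq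
      -- (n - g n) - (n - q) = q - g n
      simpa [sub_sub_sub_cancel_left] using this
    rw [hN'] at hmem
    have h0 : (q : E) - (g n : E) = 0 := (mem_bot A).1 hmem
    exact Subtype.ext (sub_eq_zero.1 h0).symm |>.symm
  -- `g` is additive and `A`-homogeneous, hence a linear map, hence zero.
  have gadd : ∀ m n : N, g (m + n) = g m + g n := by
    intro m n
    refine (huq (m + n) (g m + g n) ?_).symm
    have := N'.add_mem (hg m) (hg n)
    simpa [Submodule.coe_add, add_sub_add_comm] using this
  have gsmul : ∀ (a : A) (n : N), g (a • n) = a • g n := by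
    intro a n
    refine (huq (a • n) (a • g n) ?_).symm
    have := N'.smul_mem a (hg n)
    simpa [Submodule.coe_smul, smul_sub] using this
  let gl : N →ₗ[A] Q := { toFun := g, map_add' := gadd, map_smul' := gsmul }
  have hg0 : ∀ n : N, g n = 0 := fun n => by
    have := congrArg (fun f : N →ₗ[A] Q => f n) (hHom gl)
    simpa [gl] using this
  -- Hence `N ≤ N'`; symmetric roles are not needed: complements of `Q` in `T` with `N ≤ N'` are equal.
  have hle : N ≤ N' := by
    intro x hx
    have := hg ⟨x, hx⟩
    simpa [hg0] using this
  -- `N' = N' ⊓ T = N' ⊓ (N ⊔ Q) = N ⊔ (N' ⊓ Q) = N` by modularity.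
  apply le_antisymm hle
  have hmod := sup_inf_assoc_of_le (Q) hle   -- (N ⊔ Q) ⊓ N' = N ⊔ Q ⊓ N'
  have hN'le : N' ≤ N ⊔ Q := by rw [hNT, ← hN'T]; exact le_sup_left
  have hEq : N' = N := by
    calc N' = (N ⊔ Q) ⊓ N' := (inf_eq_right.2 hN'le).symm
      _ = N ⊔ Q ⊓ N' := hmod
      _ = N := by rw [inf_comm, hN', sup_bot_eq]
  exact hEq.le

/-- Variant of `exists_compl_of_two_step` with hypothesis (iv′) replaced by its source (iv):
every `A`-linear map from an `A`-complement of `Wa` inside `Wb` to `Wa` vanishes. -/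
theorem exists_compl_of_two_step' (Wa Wb : Submodule B E) (hab : Wa ≤ Wb)
    (hHom : ∀ N : Submodule A E, N ⊓ Wa.restrictScalars A = ⊥ →
      N ⊔ Wa.restrictScalars A = Wb.restrictScalars A → ∀ f : N →ₗ[A] Wa.restrictScalars A, f = 0)
    (hD1 : (∃ N : Submodule A E,
        N ⊓ Wa.restrictScalars A = ⊥ ∧ N ⊔ Wa.restrictScalars A = Wb.restrictScalars A) →
      ∃ P : Submodule B E, P ⊓ Wa = ⊥ ∧ P ⊔ Wa = Wb)
    (hD3 : ∀ P : Submodule B E, P ⊓ Wa = ⊥ → P ⊔ Wa = Wb →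
      (∃ N : Submodule A E, P.restrictScalars A ≤ N ∧
          N ⊓ Wb.restrictScalars A = P.restrictScalars A ∧ N ⊔ Wa.restrictScalars A = ⊤) →
      ∃ R : Submodule B E, P ≤ R ∧ R ⊓ Wb = P ∧ R ⊔ Wa = ⊤)
    (hN : ∃ N : Submodule A E, N ⊓ Wa.restrictScalars A = ⊥ ∧ N ⊔ Wa.restrictScalars A = ⊤) :
    ∃ R : Submodule B E, R ⊓ Wa = ⊥ ∧ R ⊔ Wa = ⊤ :=
  exists_compl_of_two_step Wa Wb hab
    (fun N _ hN1 hN2 hN'1 hN'2 =>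
      compl_unique_of_forall_hom_eq_zero hN2 hN'1 hN'2 (hHom N hN1 hN2))
    hD1 hD3 hN

end Summit.KontsevichZagierPeriods.KontsevichZagierPeriods.Theorems
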